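import Summits.CriticalPhenomena.CardyFormulaZ2.Theses.CardySelfRefinement

/-!
# Strategist sketch (planner-cstrat-stmt-CriticalPhenomena-10266-s1-0): the RESTATEMENT PACKAGE for
# `TrivialSectorRate` (stmt-CriticalPhenomena-10266) — drafted one-line Props in the ROUTE FILE's own
# vocabulary (same imports, same `let`-prelude), for the tenure planner's `route edit --restate` / `workitem add`.

* `TrivialSectorRateRect` (R1): the typed crux restricted to RECTILINEAR POLYGONAL quad families (power rate kept).
* `TrivialSectorRateR` (R2, recommended): rectilinear families AND the error weakened to what `RussoDrift`
  actually consumes — a uniform-in-`s` error function `ε η → 0` (cf. `tendsto_sub_of_forced_tangency`, hypothesis `hε`).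
* `RussoDriftR`: `RussoDrift` with hypothesis `TrivialSectorRateR` and conclusion for rectilinear families.
* `tsr_rect_of_tsr`, `tsr_R_of_rect`: the typed crux implies R1 implies R2 (so every landed line file transfers).
-/

namespace Summit.CriticalPhenomena.CardyFormulaZ2.Theses.CardySelfRefinement.Strategist

open scoped BigOperators Topology Classical MeasureTheory
open Filter Set MeasureTheory

/-- R1: `TrivialSectorRate` for rectilinear polygonal quad families only. -/
def TrivialSectorRateRect : Prop :=
  let ax : ℕ → Literature.Probability.LatticeModels.Site 2 × Fin 2 → Prop := fun k e => (k : ℤ) ∣ e.1 (if e.2 = 0 then 1 else 0); let tb : ℕ → Literature.Probability.LatticeModels.Site 2 × Fin 2 → Literature.Probability.LatticeModels.Site 2 := fun k e i => e.1 i / (k : ℤ); let opn : ℕ → Set (Literature.Probability.LatticeModels.Site 2 × Fin 2 × Fin 3) → Literature.Probability.LatticeModels.Site 2 × Fin 2 → Prop := fun k S e => if ax k e then ((tb k e, e.2, (2 : Fin 3)) ∈ S ∧ (tb k e, e.2, (1 : Fin 3)) ∈ S) ∨ ((tb k e, e.2, (2 : Fin 3)) ∉ S ∧ (e.1, e.2,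 (0 : Fin 3)) ∈ S) else (e.1, e.2, (0 : Fin 3)) ∈ S; let cfg : ℕ → Set (Literature.Probability.LatticeModels.Site 2 × Fin 2 × Fin 3) → Literature.Probability.Percolation.BondConfig (Literature.Probability.LatticeModels.Site 2) := fun k S => {e | ∃ (v : Literature.Probability.LatticeModels.Site 2) (d : Fin 2), e = s(v, v + (if d = 0 then ![1, 0] else ![0, 1])) ∧ opn k S (v, d)}; let prm : ℕ → ℝ → ℝ → Literature.Probability.LatticeModels.Site 2 × Fin 2 × Fin 3 → unitInterval := fun k ρ c i => if i.2.2 = 0 then (if ax k (i.1, i.2.1) then Literature.Probability.Percolation.half else Set.projIcc (0 : ℝ) 1 zero_le_one c) else if i.2.2 = 1 then Literature.Probability.Percolation.half else Set.projIcc (0 : ℝ) 1 zero_le_one ρ; let M : ℕ → ℝ → ℝ → MeasureTheory.Measure (Literature.Probability.Percolation.BondConfig (Literature.Probability.LatticeModels.Site 2)) := fun k ρ c => (Literature.Probability.LatticeModels.prodBernoulli (prm k ρ c)).map (cfg k); let A : (m : ℕ) → (Fin m → Literature.Probability.Percolation.QuadCrossing.Quad (Set.univ : Set ℂ)) → ℝ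 → Set (Literature.Probability.Percolation.BondConfig (Literature.Probability.LatticeModels.Site 2)) := fun m F η => {ω | ∀ i, F i ∈ Literature.Probability.Percolation.QuadCrossing.configOf Literature.Probability.LatticeModels.squareLatticeEmbedding.z η Set.univ ω}; let P : ℕ → (m : ℕ) → (Fin m → Literature.Probability.Percolation.QuadCrossing.Quad (Set.univ : Set ℂ)) → ℝ → ℝ → ℝ → ℝ := fun k m F η ρ c => (M k ρ c).real (A m F η); let Dρ : ℕ → (m : ℕ) → (Fin m → Literature.Probability.Percolation.QuadCrossing.Quad (Set.univ : Set ℂ)) → ℝ → ℝ × ℝ → ℝ := fun k m F η q => derivWithin (fun ρ' => P k m F η ρ' q.2) (Set.Icc 0 1) q.1; let Dc : ℕ → (m : ℕ) → (Fin m → Literature.Probability.Percolation.QuadCrossing.Quad (Set.univ : Set ℂ)) → ℝ → ℝ × ℝ → ℝ := fun k m F η q => derivWithin (fun c' => P k m F η q.1 c') (Set.Icc 0 1) q.2; let PathOK : ℕ → (unitInterval → ℝ × ℝ) → Prop := fun k γ => Continuous γ ∧ γ 0 = (1, 0) ∧ γ 1 = (0, 1 / 2) ∧ (∀ s, γ s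 ∈ Set.Icc (0 : ℝ) 1 ×ˢ Set.Icc (0 : ℝ) 1) ∧ BoundedVariationOn (fun s => (γ s).1) Set.univ ∧ BoundedVariationOn (fun s => (γ s).2) Set.univ ∧ ∀ a : ℝ, 0 < a → ∃ c₀ > 0, ∃ n₀ : ℕ, ∀ s, Literature.Probability.LatticeModels.BoxCrossingBounds (M k (γ s).1 (γ s).2) Literature.Probability.LatticeModels.squareLatticeEmbedding.z a c₀ n₀; let IsRect : (m : ℕ) → (Fin m → Literature.Probability.Percolation.QuadCrossing.Quad (Set.univ : Set ℂ)) → Prop := fun m F => ∀ i, ∃ S : Finset (ℂ × ℂ), (∀ p ∈ S, p.1.re = p.2.re ∨ p.1.im = p.2.im) ∧ frontier (Set.range (F i)) = ⋃ p ∈ S, segment ℝ p.1 p.2; ∀ k : ℕ, k = 2 ∨ k = 3 → ∀ γ : unitInterval → ℝ × ℝ, PathOK k γ → ∀ (m : ℕ) (F : Fin m → Literature.Probability.Percolation.QuadCrossing.Quad (Set.univ : Set ℂ)), IsRect m F → ∃ θ : ℝ, 0 < θ ∧ ∃ κ₁ κ₂ : unitInterval → ℝ, Continuous κ₁ ∧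 Continuous κ₂ ∧ (∀ s, κ₁ s ≠ 0 ∨ κ₂ s ≠ 0) ∧ ∃ C η₀ : ℝ, 0 < η₀ ∧ ∀ s : unitInterval, ∀ η ∈ Set.Ioo 0 η₀, |κ₂ s * Dρ k m F η (γ s) - κ₁ s * Dc k m F η (γ s)| ≤ C * η ^ θ

/-- R2 (recommended restatement): rectilinear families, `o(1)` error uniform in `s`. -/
def TrivialSectorRateR : Prop :=
  let ax : ℕ → Literature.Probability.LatticeModels.Site 2 × Fin 2 → Prop := fun k e => (k : ℤ) ∣ e.1 (if e.2 = 0 then 1 else 0); let tb : ℕ → Literature.Probability.LatticeModels.Site 2 × Fin 2 → Literature.Probability.LatticeModels.Site 2 := fun k e i => e.1 i / (k : ℤ); let opn : ℕ → Set (Literature.Probability.LatticeModels.Site 2 × Fin 2 × Fin 3) → Literature.Probability.LatticeModels.Site 2 × Fin 2 → Prop := fun k S e => if ax k e then ((tb k e, e.2, (2 : Fin 3)) ∈ S ∧ (tb k e, e.2, (1 : Fin 3)) ∈ S) ∨ ((tb k e, e.2, (2 : Fin 3)) ∉ S ∧ (e.1, e.2, (0 : Fin 3)) ∈ S) else (e.1,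 e.2, (0 : Fin 3)) ∈ S; let cfg : ℕ → Set (Literature.Probability.LatticeModels.Site 2 × Fin 2 × Fin 3) → Literature.Probability.Percolation.BondConfig (Literature.Probability.LatticeModels.Site 2) := fun k S => {e | ∃ (v : Literature.Probability.LatticeModels.Site 2) (d : Fin 2), e = s(v, v + (if d = 0 then ![1, 0] else ![0, 1])) ∧ opn k S (v, d)}; let prm : ℕ → ℝ → ℝ → Literature.Probability.LatticeModels.Site 2 × Fin 2 × Fin 3 → unitInterval := fun k ρ c i => if i.2.2 = 0 then (if ax k (i.1, i.2.1) then Literature.Probability.Percolation.half else Set.projIcc (0 : ℝ) 1 zero_le_one c) else if i.2.2 = 1 then Literature.Probability.Percolation.half else Set.projIcc (0 : ℝ) 1 zero_le_one ρ; let M : ℕ → ℝ → ℝ → MeasureTheory.Measure (Literature.Probability.Percolation.BondConfig (Literature.Probability.LatticeModels.Site 2)) := fun k ρ c => (Literature.Probability.LatticeModels.prodBernoulli (prm k ρ c)).map (cfg k); let A : (m : ℕ) → (Fin m → Literature.Probability.Percolation.QuadCrossing.Quad (Set.univ : Set ℂ)) → ℝ → Set (Literature.Probability.Percolation.BondConfig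 (Literature.Probability.LatticeModels.Site 2)) := fun m F η => {ω | ∀ i, F i ∈ Literature.Probability.Percolation.QuadCrossing.configOf Literature.Probability.LatticeModels.squareLatticeEmbedding.z η Set.univ ω}; let P : ℕ → (m : ℕ) → (Fin m → Literature.Probability.Percolation.QuadCrossing.Quad (Set.univ : Set ℂ)) → ℝ → ℝ → ℝ → ℝ := fun k m F η ρ c => (M k ρ c).real (A m F η); let Dρ : ℕ → (m : ℕ) → (Fin m → Literature.Probability.Percolation.QuadCrossing.Quad (Set.univ : Set ℂ)) → ℝ → ℝ × ℝ → ℝ := fun k m F η q => derivWithin (fun ρ' => P k m F η ρ' q.2) (Set.Icc 0 1) q.1; let Dc : ℕ → (m : ℕ) → (Fin m → Literature.Probability.Percolation.QuadCrossing.Quad (Set.univ : Set ℂ)) → ℝ → ℝ × ℝ → ℝ := fun k m F η q => derivWithin (fun c' => P k m F η q.1 c') (Set.Icc 0 1) q.2; let PathOK : ℕ → (unitInterval → ℝ × ℝ) → Prop := fun k γ => Continuous γ ∧ γ 0 = (1, 0) ∧ γ 1 = (0, 1 / 2) ∧ (∀ s, γ s ∈ Set.Icc (0 : ℝ) 1 ×ˢ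 Set.Icc (0 : ℝ) 1) ∧ BoundedVariationOn (fun s => (γ s).1) Set.univ ∧ BoundedVariationOn (fun s => (γ s).2) Set.univ ∧ ∀ a : ℝ, 0 < a → ∃ c₀ > 0, ∃ n₀ : ℕ, ∀ s, Literature.Probability.LatticeModels.BoxCrossingBounds (M k (γ s).1 (γ s).2) Literature.Probability.LatticeModels.squareLatticeEmbedding.z a c₀ n₀; let IsRect : (m : ℕ) → (Fin m → Literature.Probability.Percolation.QuadCrossing.Quad (Set.univ : Set ℂ)) → Prop := fun m F => ∀ i, ∃ S : Finset (ℂ × ℂ), (∀ p ∈ S, p.1.re = p.2.re ∨ p.1.im = p.2.im) ∧ frontier (Set.range (F i)) = ⋃ p ∈ S, segment ℝ p.1 p.2; ∀ k : ℕ, k = 2 ∨ k = 3 → ∀ γ : unitInterval → ℝ × ℝ, PathOK k γ → ∀ (m : ℕ) (F : Fin m → Literature.Probability.Percolation.QuadCrossing.Quad (Set.univ : Set ℂ)), IsRect m F → ∃ κ₁ κ₂ : unitInterval → ℝ, Continuous κ₁ ∧ Continuous κ₂ ∧ (∀ s, κ₁ s ≠ 0 ∨ κ₂ s ≠ 0)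 ∧ ∃ ε : ℝ → ℝ, Filter.Tendsto ε (nhdsWithin 0 (Set.Ioi 0)) (nhds 0) ∧ ∃ η₀ : ℝ, 0 < η₀ ∧ ∀ s : unitInterval, ∀ η ∈ Set.Ioo 0 η₀, |κ₂ s * Dρ k m F η (γ s) - κ₁ s * Dc k m F η (γ s)| ≤ ε η

/-- `RussoDrift` re-typed against R2 (conclusion for rectilinear families). -/
def RussoDriftR : Prop :=
  TrivialSectorRateR → CriticalPathRSW → GradientComparability → let ax : ℕ → Literature.Probability.LatticeModels.Site 2 × Fin 2 → Prop := fun k e => (k : ℤ) ∣ e.1 (if e.2 = 0 then 1 else 0); let tb : ℕ → Literature.Probability.LatticeModels.Site 2 × Fin 2 → Literature.Probability.LatticeModels.Site 2 := fun k e i => e.1 i / (k : ℤ); let opn : ℕ → Set (Literature.Probability.LatticeModels.Site 2 × Fin 2 × Fin 3) → Literature.Probability.LatticeModels.Site 2 × Fin 2 → Prop := fun k S e => if ax k e then ((tb k e, e.2, (2 : Fin 3)) ∈ S ∧ (tb k e, e.2, (1 : Fin 3)) ∈ S) ∨ ((tb k e, e.2, (2 : Fin 3)) ∉ S ∧ (e.1,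 e.2, (0 : Fin 3)) ∈ S) else (e.1, e.2, (0 : Fin 3)) ∈ S; let cfg : ℕ → Set (Literature.Probability.LatticeModels.Site 2 × Fin 2 × Fin 3) → Literature.Probability.Percolation.BondConfig (Literature.Probability.LatticeModels.Site 2) := fun k S => {e | ∃ (v : Literature.Probability.LatticeModels.Site 2) (d : Fin 2), e = s(v, v + (if d = 0 then ![1, 0] else ![0, 1])) ∧ opn k S (v, d)}; let prm : ℕ → ℝ → ℝ → Literature.Probability.LatticeModels.Site 2 × Fin 2 × Fin 3 → unitInterval := fun k ρ c i => if i.2.2 = 0 then (if ax k (i.1, i.2.1) then Literature.Probability.Percolation.half else Set.projIcc (0 : ℝ) 1 zero_le_one c) else if i.2.2 = 1 then Literature.Probability.Percolation.half else Set.projIcc (0 : ℝ) 1 zero_le_one ρ; let M : ℕ → ℝ → ℝ → MeasureTheory.Measure (Literature.Probability.Percolation.BondConfig (Literature.Probability.LatticeModels.Site 2)) := fun k ρ c => (Literature.Probability.LatticeModels.prodBernoulli (prm k ρ c)).map (cfg k); let A : (m : ℕ) → (Fin m → Literature.Probability.Percolation.QuadCrossing.Quad (Set.univ : Set ℂ))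 → ℝ → Set (Literature.Probability.Percolation.BondConfig (Literature.Probability.LatticeModels.Site 2)) := fun m F η => {ω | ∀ i, F i ∈ Literature.Probability.Percolation.QuadCrossing.configOf Literature.Probability.LatticeModels.squareLatticeEmbedding.z η Set.univ ω}; let P : ℕ → (m : ℕ) → (Fin m → Literature.Probability.Percolation.QuadCrossing.Quad (Set.univ : Set ℂ)) → ℝ → ℝ → ℝ → ℝ := fun k m F η ρ c => (M k ρ c).real (A m F η); let IsRect : (m : ℕ) → (Fin m → Literature.Probability.Percolation.QuadCrossing.Quad (Set.univ : Set ℂ)) → Prop := fun m F => ∀ i, ∃ S : Finset (ℂ × ℂ), (∀ p ∈ S, p.1.re = p.2.re ∨ p.1.im = p.2.im) ∧ frontier (Set.range (F i)) = ⋃ p ∈ S, segment ℝ p.1 p.2; (∀ k : ℕ, k = 2 ∨ k = 3 → ∀ (m : ℕ) (F : Fin m → Literature.Probability.Percolation.QuadCrossing.Quad (Set.univ : Set ℂ)), IsRect m F → Filter.Tendsto (fun η => P k m F η 1 0 - P k m F η 0 (1 / 2)) (nhdsWithin 0 (Set.Ioi 0)) (nhds 0))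

theorem tsr_rect_of_tsr : TrivialSectorRate → TrivialSectorRateRect := by
  intro h k hk γ hγ m F _hF
  exact h k hk γ hγ m F

theorem tsr_R_of_rect : TrivialSectorRateRect → TrivialSectorRateR := by
  intro h k hk γ hγ m F hF
  obtain ⟨θ, hθ, κ₁, κ₂, hκ₁, hκ₂, hnv, C, η₀, hη₀, hb⟩ := h k hk γ hγ m F hF
  refine ⟨κ₁, κ₂, hκ₁, hκ₂, hnv, fun η => C * η ^ θ, ?_, η₀, hη₀, fun s η hη => hb s η hη⟩
  have h1 : Filter.Tendsto (fun η : ℝ => η ^ θ) (nhds 0) (nhds 0) := by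
    have := (Real.continuousAt_rpow_const 0 θ (Or.inr hθ.le)).tendsto
    simpa [Real.zero_rpow hθ.ne'] using this
  have h2 := h1.const_mul C
  rw [mul_zero] at h2
  exact h2.mono_left nhdsWithin_le_nhds

end Summit.CriticalPhenomena.CardyFormulaZ2.Theses.CardySelfRefinement.Strategist
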